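import Literature.AlgebraicGeometry.Resolution.MuPTorsorLocalUniformizationRelative
import Literature.AlgebraicGeometry.Resolution.ZariskiPatchingProperModelsWeakLU
import HarnessLib

/-!
# Resolution in characteristic `p` = proper two-model patching ∧ the core `μ_p`-torsor step at
# rank-one valuations (relative model form)

Summit-side packaging of `Literature/…/MuPTorsorLocalUniformizationRelative.lean`
(Novacoski–Spivakovsky 2014 reduction to rank one, proved in the tree; Temkin 2013 in height
one; Cossart–Piltant 2019 in dimension `≤ 3`; Cutkosky 2022 at Abhyankar places, proved in the
tree) with Zariski–Piltant patching of proper models in its weak-LU form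
(`Literature/…/ZariskiPatchingProperModelsWeakLU.lean`):

* `rankOneRelCoreSteps_of_resolutionInChar` — resolution in characteristic `p` implies the core
  `μ_p`-torsor steps in model form (`RelMuPTorsorCoreStepsAt`) at EVERY valuation ring over every
  field of characteristic `p` (unconditional; in particular at the rank-one ones);
  `not_resolutionOfSingularities_of_not_relCoreStepsAt` — the kill switch: one regular finitely
  generated `A₀ ⊆ O` and one new `p`-th root `a` (`a^p ∈ A₀`, `trdeg > 3`, non-Abhyankar) NOT
  dominated by a regular finitely generated model containing `a` refutes the summit;
* `resolutionInChar_iff_twoModelPatching_and_rankOneRelCoreSteps` — **the split at rank one**: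
  granted the two published theorems `Temkin2013HeightLeOne` (Temkin 2013, §4.1: inseparable
  local uniformization of valuations of height `≤ 1`) and `CossartPiltant2019LU3`,
  `ResolutionInChar p ↔ ProperModel.TwoModelPatching p ∧ (core model-form steps at the RANK-ONE
  valuation rings of finitely generated extensions, over all fields of characteristic p)`
  (the local conjunct is spelled out in every statement);
  `resolutionOfSingularities_iff_twoModelPatching_and_rankOneRelCoreSteps` — the same for the
  summit statement itself (all primes, universe `0`).

Compared with `SoloInformedCore` the local conjunct is (i) restricted to rank-one (archimedean)
valuations, (ii) relative to a PRESCRIBED regular model `A₀` (Cossart–Piltant's working shape: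
resolve the `μ_p`-torsor `A₀[a]` over the regular local ring `(A₀)_{𝔪 ∩ A₀}` along `v`), and
(iii) consumes only the height-one case of Temkin's theorem.
-/

noncomputable section

namespace Summit.ResolutionOfSingularities.ResolutionOfSingularities.Theorems

open CategoryTheory AlgebraicGeometry IsLocalRing
open Literature.AlgebraicGeometry Literature.AlgebraicGeometry.Resolution

universe u

/-- Resolution in characteristic `p` implies the core model-form torsor steps at every valuation
ring over every field of characteristic `p` (unconditional: resolution gives relative local
uniformization of every `O ∩ K'`). -/
theorem relCoreSteps_of_resolutionInChar {p : ℕ} [Fact p.Prime] (h : ResolutionInChar.{0} p)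
    (k K : Type) [Field k] [CharP k p] [Field K] [Algebra k K] (O : ValuationSubring K)
    (hk : ∀ c : k, algebraMap k K c ∈ O) : RelMuPTorsorCoreStepsAt p k O :=
  relCoreStepsAt_of_relLocalUniformization O hk fun K' =>
    h.relLocalUniformization k K' (O.comap (algebraMap K' K))

/-- Resolution in characteristic `p` implies the core model-form torsor steps at the rank-one
valuation rings of finitely generated extensions (the shape of the local conjunct below). -/
theorem rankOneRelCoreSteps_of_resolutionInChar {p : ℕ} [Fact p.Prime]
    (h : ResolutionInChar.{0} p) :
    ∀ (k K : Type) [Field k] [CharP k p] [Field K] [Algebra k K],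
      (⊤ : IntermediateField k K).FG → ∀ O : ValuationSubring K,
        Nonempty O.valuation.RankOne → (∀ c : k, algebraMap k K c ∈ O) →
          RelMuPTorsorCoreStepsAt p k O :=
  fun k K _ _ _ _ _ O _ hk => relCoreSteps_of_resolutionInChar h k K O hk

/-- **Kill switch, relative core form.** A single valuation ring `O` over a single field `k` of
characteristic `p`, a single finitely generated `A₀ ⊆ O` regular at the centre and a single
`a ∉ Frac A₀` with `a^p ∈ A₀` (`trdeg_k Frac A₀(a) > 3`, `O ∩ Frac A₀(a)` non-Abhyankar) that
admit NO finitely generated `A ∋ a`, `A₀ ⊆ A ⊆ O ∩ Frac A₀(a)`, regular at the centre of `O`,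
refute resolution of singularities. -/
theorem not_resolutionOfSingularities_of_not_relCoreStepsAt {p : ℕ} (hp : p.Prime)
    {k K : Type} [Field k] [CharP k p] [Field K] [Algebra k K] (O : ValuationSubring K)
    (hk : ∀ c : k, algebraMap k K c ∈ O) (h : ¬ RelMuPTorsorCoreStepsAt p k O) :
    ¬ Literature.AlgebraicGeometry.Resolution.ResolutionOfSingularities := by
  intro hR
  haveI : Fact p.Prime := ⟨hp⟩
  exact h (relCoreSteps_of_resolutionInChar (hR p hp) k K O hk)

/-- **Rank-one core steps over `k` + Temkin (height one) + Cossart–Piltant (dim ≤ 3) + proper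
two-model patching over `k` ⇒ weak resolution over `k` in every dimension**, for an arbitrary
field `k` of characteristic `p` (universe `0`). -/
theorem resolutionOverUpToDim_of_rankOneRelCoreSteps_of_properPatching {p : ℕ} [Fact p.Prime]
    (hT₁ : Temkin2013HeightLeOne.{0}) (hCP : CossartPiltant2019LU3.{0}) {k : Type} [Field k]
    [CharP k p]
    (H : ∀ (K : Type) [Field K] [Algebra k K], (⊤ : IntermediateField k K).FG →
      ∀ O : ValuationSubring K, Nonempty O.valuation.RankOne →
        (∀ c : k, algebraMap k K c ∈ O) → RelMuPTorsorCoreStepsAt p k O)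
    (hZ : ∀ (K : Type) [Field K] [Algebra k K] [Algebra.EssFiniteType k K],
      ∀ M₁ M₂ : ProperModel k K,
        ∃ (N : ProperModel k K) (φ₁ : N.Hom M₁) (φ₂ : N.Hom M₂), φ₁.RegLe ∧ φ₂.RegLe)
    (d : ℕ) : ResolutionOverUpToDim k d :=
  resolutionOverUpToDim_of_properPatching_of_lu hZ
    (fun K _ _ hfg O hO => isLocallyUniformizable_of_relLocalUniformization hfg O hO
      (relLocalUniformization_of_rankOne_relCoreSteps hT₁ hCP H K O))
    d

/-- **The split of the summit's `p`-component at rank one.** Granted Temkin's inseparable local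
uniformization in height one and Cossart–Piltant's resolution in dimension `≤ 3`, resolution of
singularities in characteristic `p` is EQUIVALENT to the conjunction of (global) two-model
patching of proper models and (local) the core model-form `μ_p`-torsor steps at the rank-one
valuation rings of finitely generated extensions, over all fields of characteristic `p`. -/
theorem resolutionInChar_iff_twoModelPatching_and_rankOneRelCoreSteps {p : ℕ} [Fact p.Prime]
    (hT₁ : Temkin2013HeightLeOne.{0}) (hCP : CossartPiltant2019LU3.{0}) :
    ResolutionInChar.{0} p ↔ ProperModel.TwoModelPatching.{0} p ∧
      (∀ (k K : Type) [Field k] [CharP k p] [Field K] [Algebra k K],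
        (⊤ : IntermediateField k K).FG → ∀ O : ValuationSubring K,
          Nonempty O.valuation.RankOne → (∀ c : k, algebraMap k K c ∈ O) →
            RelMuPTorsorCoreStepsAt p k O) :=
  ⟨fun h => ⟨ProperModel.twoModelPatching_of_resolutionInChar h,
      rankOneRelCoreSteps_of_resolutionInChar h⟩,
    fun h => resolutionInChar_of_properTwoModelPatching_of_lu h.1
      (localUniformizationInChar_of_rankOne_relCoreSteps hT₁ hCP h.2)⟩

/-- The same granted the full relative theorem `Temkin2013Relative` (which contains its
height-one case) and the full Cossart–Piltant theorem `CossartPiltant2019`. -/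
theorem resolutionInChar_iff_twoModelPatching_and_rankOneRelCoreSteps' {p : ℕ} [Fact p.Prime]
    (hT : Temkin2013Relative.{0}) (hCP : CossartPiltant2019.{0}) :
    ResolutionInChar.{0} p ↔ ProperModel.TwoModelPatching.{0} p ∧
      (∀ (k K : Type) [Field k] [CharP k p] [Field K] [Algebra k K],
        (⊤ : IntermediateField k K).FG → ∀ O : ValuationSubring K,
          Nonempty O.valuation.RankOne → (∀ c : k, algebraMap k K c ∈ O) →
            RelMuPTorsorCoreStepsAt p k O) :=
  resolutionInChar_iff_twoModelPatching_and_rankOneRelCoreSteps (hT.heightLE 1) hCP.lu3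

/-- **Exact local proxy at rank one.** Granted Temkin (height one) and Cossart–Piltant
(dim ≤ 3): relative local uniformization in characteristic `p` (over all ground fields of
characteristic `p`) is EQUIVALENT to the core model-form steps at rank-one valuation rings, and
resolution in characteristic `p` implies both. -/
theorem resolutionInChar_localProxy_rankOne {p : ℕ} [Fact p.Prime]
    (hT₁ : Temkin2013HeightLeOne.{0}) (hCP : CossartPiltant2019LU3.{0}) :
    (ResolutionInChar.{0} p →
      ∀ (k K : Type) [Field k] [CharP k p] [Field K] [Algebra k K],
        (⊤ : IntermediateField k K).FG → ∀ O : ValuationSubring K,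
          Nonempty O.valuation.RankOne → (∀ c : k, algebraMap k K c ∈ O) →
            RelMuPTorsorCoreStepsAt p k O) ∧
      ((∀ (k K : Type) [Field k] [CharP k p] [Field K] [Algebra k K] (O : ValuationSubring K),
          (∀ c : k, algebraMap k K c ∈ O) → RelLocalUniformization k K O) ↔
        ∀ (k K : Type) [Field k] [CharP k p] [Field K] [Algebra k K],
          (⊤ : IntermediateField k K).FG → ∀ O : ValuationSubring K,
            Nonempty O.valuation.RankOne → (∀ c : k, algebraMap k K c ∈ O) →
              RelMuPTorsorCoreStepsAt p k O) :=
  ⟨rankOneRelCoreSteps_of_resolutionInChar, relLocalUniformization_iff_rankOne_relCoreSteps hT₁ hCP⟩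

/-- **The summit itself, split at rank one.** Granted Temkin (height one) and Cossart–Piltant
(dim ≤ 3) in universe `0`: resolution of singularities in positive characteristic (the summit
statement, verbatim `Literature.AlgebraicGeometry.Resolution.ResolutionOfSingularities`) is
EQUIVALENT to: for every prime `p`, two-model patching of proper models in characteristic `p`
AND the core model-form `μ_p`-torsor steps at the rank-one valuation rings of finitely generated
extensions of fields of characteristic `p`. -/
theorem resolutionOfSingularities_iff_twoModelPatching_and_rankOneRelCoreSteps
    (hT₁ : Temkin2013HeightLeOne.{0}) (hCP : CossartPiltant2019LU3.{0}) :
    Literature.AlgebraicGeometry.Resolution.ResolutionOfSingularities ↔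
      ∀ p : ℕ, p.Prime → ProperModel.TwoModelPatching.{0} p ∧
      (∀ (k K : Type) [Field k] [CharP k p] [Field K] [Algebra k K],
        (⊤ : IntermediateField k K).FG → ∀ O : ValuationSubring K,
          Nonempty O.valuation.RankOne → (∀ c : k, algebraMap k K c ∈ O) →
            RelMuPTorsorCoreStepsAt p k O) := by
  refine forall_congr' fun p => forall_congr' fun hp => ?_
  haveI : Fact p.Prime := ⟨hp⟩
  exact resolutionInChar_iff_twoModelPatching_and_rankOneRelCoreSteps hT₁ hCP

end Summit.ResolutionOfSingularities.ResolutionOfSingularities.Theorems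

end
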